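import Summits.SmoothPoincare4.SmoothPoincare4.Theorems.EntropyRungNoncompactShrinkerGapHeatTwoSidedBound
import Summits.SmoothPoincare4.SmoothPoincare4.Theorems.EntropyRungNoncompactShrinkerGapHeatCutoffToolkit
import Literature.Geometry.Lorentzian.HessianLinear
import HarnessLib

/-!
# Lipschitz start and bounded generator for the energy-class weighted heat flow on a complete
# weighted manifold (crux `EntropyRung.NoncompactShrinkerGap`, stmt-SmoothPoincare4-10868,
# line `collapsed-ends-usc`; helpers of the stub `helper_liWangAllScales`)

Setting (the shrinker heat toolkit of leads c8/c9, namespace `…Theorems.NoncompactShrinkerGapHeat`):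
`M` modelled on `ℝⁿ` (Hausdorff, second countable, `T₃`, Borel — NOT compact), `g` Riemannian with its
Levi-Civita connection, `V` smooth with `e^{-V} ∈ L¹(dV_g)`, `L = Δ_g − g⁻¹(dV, d·)`, cut-offs
`η_k ∈ C_c^∞` with `0 ≤ η_k ≤ η_{k+1} ≤ 1`, `η_k = 1` near every point for large `k` and `|Lη_k| ≤ C`;
a solution `ρ` of `∂ₛρ = Lρ` on `[0, T]`, smooth on `M × O` (`O ⊇ [0, T]` open), in the energy class
`(ρ − c)² e^{-V} ∈ L¹(M × (0, T))` (the class produced by `helper_heatFlowExistence`).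

* `heatFlow_sub_datum_abs_le` — `|ρ(s) − ρ(0)| ≤ C_L s` when `|Lρ(0)| ≤ C_L` and `ρ(0) − c` is
  bounded: `±(ρ − ρ(0)) − C_L s` are subsolutions (`helper_weightedMaxPrinciple`).
* `heatFlow_weightedLaplacian_abs_le` (registered form `helper_liWangHeatLaplacianBound`) —
  `|Lρ(s)| ≤ C_L` on `[0, T)`: the difference quotients `(ρ(s + h) − ρ(s))/h` are solutions in the
  energy class (`integrable_strip_shift`, translation invariance of `ds`) starting in `[−C_L, C_L]`,
  hence stay there (`helper_twoSidedBound`), and `h → 0⁺` gives `|∂ₛρ| = |Lρ| ≤ C_L`.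

With the uniqueness of the flow in the energy class (`heatFlow_unique`,
`EntropyRungNoncompactShrinkerGapLiWangAllScales.lean`) these linear a-priori facts glue the flows `u_T`
of all horizons into one flow on `M × [0, ∞)` with bounded generator, the input of
`LiWang2020_shrinkerLSI_allScales_of_heatFlow`. Everything is proved; no definitions, no named facts.

## References

* [Grigoryan2009] A. Grigor'yan, *Heat Kernel and Analysis on Manifolds* (2009), §11.4 and §12.1
  (uniqueness class and weak maximum principle for the heat equation on a weighted manifold).
* [BakryGentilLedoux2014] D. Bakry, I. Gentil, M. Ledoux (2014), §1.4 ((1.4.3)–(1.4.4):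
  `∂_t P_t f = L P_t f = P_t L f`, `‖L P_t f‖_∞ ≤ ‖Lf‖_∞`) and §3.2 (pp. 141–147).
-/

noncomputable section

set_option linter.dupNamespace false

open scoped Manifold ContDiff ENNReal NNReal Topology
open MeasureTheory Set Filter
open Literature.Geometry.Lorentzian Literature.Geometry.Riemannian

namespace Summit.SmoothPoincare4.SmoothPoincare4.Theorems.NoncompactShrinkerGapLiWang

open NoncompactShrinkerGapHeat NoncompactShrinkerGapHeat.CutoffToolkit

section Weighted

variable {n : ℕ} {M : Type*} [TopologicalSpace M] [T2Space M] [SecondCountableTopology M]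
  [ChartedSpace (EuclideanSpace ℝ (Fin n)) M] [IsManifold (𝓡 n) ∞ M] [T3Space M]
  [MeasurableSpace M] [BorelSpace M]
  {g : PseudoRiemannianMetric (𝓡 n) ∞ (EuclideanSpace ℝ (Fin n)) (TangentSpace (𝓡 n) : M → Type _)}
  [g.HasLeviCivita]

omit [T2Space M] [SecondCountableTopology M] [T3Space M] [MeasurableSpace M] [BorelSpace M] in
/-- **`L(u + s v) = Lu + s Lv`** for `u, v` of class `C²` at the point (`L = Δ_g − g⁻¹(dV, d·)`).
[folklore] -/
theorem weightedLaplacian_add_const_mul {u v V : M → ℝ} {x : M}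
    (hu : ContMDiffAt (𝓡 n) 𝓘(ℝ, ℝ) 2 u x) (hv : ContMDiffAt (𝓡 n) 𝓘(ℝ, ℝ) 2 v x) (s : ℝ) :
    g.dalembertian (fun y ↦ u y + s * v y) x - g.innerDual x (mvfderiv (𝓡 n) V x).toLinearMap
        (mvfderiv (𝓡 n) (fun y ↦ u y + s * v y) x).toLinearMap =
      (g.dalembertian u x - g.innerDual x (mvfderiv (𝓡 n) V x).toLinearMap
        (mvfderiv (𝓡 n) u x).toLinearMap)
      + s * (g.dalembertian v x - g.innerDual x (mvfderiv (𝓡 n) V x).toLinearMap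
        (mvfderiv (𝓡 n) v x).toLinearMap) := by
  have hd : (mvfderiv (𝓡 n) (fun y ↦ u y + s * v y) x).toLinearMap =
      (mvfderiv (𝓡 n) u x).toLinearMap + s • (mvfderiv (𝓡 n) v x).toLinearMap := by
    ext a
    exact PseudoRiemannianMetric.mvfderiv_add_const_mul_apply (hu.mdifferentiableAt (by norm_num))
      (hv.mdifferentiableAt (by norm_num)) s a
  rw [g.dalembertian_add_const_mul_of_contMDiffAt hu hv s, hd, g.innerDual_comm x _ (_ + _),
    g.innerDual_add_left, g.innerDual_smul_left, g.innerDual_comm x (mvfderiv (𝓡 n) u x).toLinearMap,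
    g.innerDual_comm x (mvfderiv (𝓡 n) v x).toLinearMap]
  ring

omit [T2Space M] [g.HasLeviCivita] in
/-- The weight `e^{-V}` is integrable on the strip `M × (0, T)` when `e^{-V} ∈ L¹(M)`. [folklore] -/
theorem integrable_exp_neg_strip (hg : g.IsRiemannian) {V : M → ℝ}
    (hfin : Integrable (fun x ↦ Real.exp (-V x)) g.riemVolume) (T : ℝ) :
    Integrable (fun p : M × ℝ ↦ Real.exp (-V p.1))
      ((g.riemVolume.prod (volume : Measure ℝ)).restrict (univ ×ˢ Ioo 0 T)) := by
  haveI := CarrilloNi2009_shrinkerLSI.isFiniteMeasureOnCompacts_riemVolume hg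
  haveI := sigmaFinite_riemVolume hg
  rw [← Measure.restrict_univ (μ := g.riemVolume), ← Measure.prod_restrict, Measure.restrict_univ]
  have h := hfin.mul_prod (integrable_const (1 : ℝ) :
    Integrable (fun _ : ℝ ↦ (1 : ℝ)) ((volume : Measure ℝ).restrict (Ioo 0 T)))
  simpa using h

/-- **Lipschitz bound at the initial time**: for a solution `ρ` of `∂ₛρ = Lρ` on `[0, T]` in the
energy class with bounded `ρ(0) − c` and `|Lρ(0)| ≤ C_L`, `|ρ(s) − ρ(0)| ≤ C_L s` on `[0, T]`:
`±(ρ − ρ(0)) − C_L s` are subsolutions vanishing at `s = 0` (`L` is linear and kills constants),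
so the weak maximum principle for subsolutions (`helper_weightedMaxPrinciple`) applies.
[cite: Grigoryan2009, §11.4 and §12.1] -/
theorem heatFlow_sub_datum_abs_le (hg : g.IsRiemannian) {V : M → ℝ}
    (hV : ContMDiff (𝓡 n) 𝓘(ℝ, ℝ) ∞ V) (hfin : Integrable (fun x ↦ Real.exp (-V x)) g.riemVolume)
    {η : ℕ → M → ℝ} {C : ℝ} (hηs : ∀ k, ContMDiff (𝓡 n) 𝓘(ℝ, ℝ) ∞ (η k))
    (hηc : ∀ k, HasCompactSupport (η k)) (hη01 : ∀ k x, 0 ≤ η k x ∧ η k x ≤ 1)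
    (hηmono : ∀ k x, η k x ≤ η (k + 1) x) (hη1 : ∀ x, ∀ᶠ k in atTop, ∀ᶠ y in 𝓝 x, η k y = 1)
    (hηL : ∀ k x, |g.dalembertian (η k) x - g.innerDual x (mvfderiv (𝓡 n) V x).toLinearMap
      (mvfderiv (𝓡 n) (η k) x).toLinearMap| ≤ C)
    {T : ℝ} {O : Set ℝ} {ρ : ℝ → M → ℝ} (hT : 0 < T) (hO : IsOpen O) (hTO : Icc 0 T ⊆ O)
    (hρ : ContMDiffOn ((𝓡 n).prod 𝓘(ℝ, ℝ)) 𝓘(ℝ, ℝ) ∞ (fun p : M × ℝ ↦ ρ p.2 p.1) (univ ×ˢ O))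
    (heq : ∀ s ∈ Icc 0 T, ∀ x, deriv (fun r ↦ ρ r x) s = g.dalembertian (ρ s) x
      - g.innerDual x (mvfderiv (𝓡 n) V x).toLinearMap (mvfderiv (𝓡 n) (ρ s) x).toLinearMap)
    {c B CL : ℝ} (hB : ∀ x, |ρ 0 x - c| ≤ B)
    (hCL : ∀ x, |g.dalembertian (ρ 0) x - g.innerDual x (mvfderiv (𝓡 n) V x).toLinearMap
      (mvfderiv (𝓡 n) (ρ 0) x).toLinearMap| ≤ CL)
    (hint : Integrable (fun p : M × ℝ ↦ (ρ p.2 p.1 - c) ^ 2 * Real.exp (-V p.1))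
      ((g.riemVolume.prod (volume : Measure ℝ)).restrict (univ ×ˢ Ioo 0 T))) :
    ∀ s ∈ Icc 0 T, ∀ x, |ρ s x - ρ 0 x| ≤ CL * s := by
  intro s hs x
  have h2 : (2 : ℕ∞ω) ≤ (∞ : ℕ∞ω) := WithTop.coe_le_coe.mpr le_top
  have hexpc : Continuous fun y ↦ Real.exp (-V y) := Real.continuous_exp.comp hV.continuous.neg
  have hmeasS : MeasurableSet ((univ : Set M) ×ˢ Ioo (0 : ℝ) T) :=
    MeasurableSet.univ.prod measurableSet_Ioo
  have h0O : (0 : ℝ) ∈ O := hTO ⟨le_rfl, hT.le⟩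
  have hρ0s : ContMDiff (𝓡 n) 𝓘(ℝ, ℝ) ∞ (ρ 0) := contMDiff_slice_of_contMDiffOn hρ h0O
  have hρs : ∀ r ∈ O, ContMDiff (𝓡 n) 𝓘(ℝ, ℝ) ∞ (ρ r) := fun r hr ↦ contMDiff_slice_of_contMDiffOn hρ hr
  have hCL0 : 0 ≤ CL := (abs_nonneg _).trans (hCL x)
  have hB0 : 0 ≤ B := (abs_nonneg _).trans (hB x)
  have hbound : Integrable (fun p : M × ℝ ↦ (ρ p.2 p.1 - c) ^ 2 * Real.exp (-V p.1) +
      (1 + B) * Real.exp (-V p.1)) ((g.riemVolume.prod (volume : Measure ℝ)).restrict (univ ×ˢ Ioo 0 T)) :=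
    hint.add ((integrable_exp_neg_strip hg hfin T).const_mul (1 + B))
  have key : ∀ σ : ℝ, |σ| = 1 → σ * (ρ s x - ρ 0 x) - CL * s ≤ 0 := by
    intro σ hσ
    set z : ℝ → M → ℝ := fun r y ↦ σ * (ρ r y - ρ 0 y) - CL * r with hzdef
    have hzs : ContMDiffOn ((𝓡 n).prod 𝓘(ℝ, ℝ)) 𝓘(ℝ, ℝ) ∞ (fun p : M × ℝ ↦ z p.2 p.1) (univ ×ˢ O) :=
      (contMDiffOn_const.mul (hρ.sub (hρ0s.comp contMDiff_fst).contMDiffOn)).sub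
        (contMDiffOn_const.mul contMDiff_snd.contMDiffOn)
    have hsub : ∀ r ∈ Icc 0 T, ∀ y, deriv (fun r' ↦ z r' y) r ≤ g.dalembertian (z r) y -
        g.innerDual y (mvfderiv (𝓡 n) V y).toLinearMap (mvfderiv (𝓡 n) (z r) y).toLinearMap := by
      intro r hr y
      have hrO := hTO hr
      have hd : HasDerivAt (fun r' ↦ z r' y) (σ * deriv (fun r' ↦ ρ r' y) r - CL * 1) r :=
        (((hasDerivAt_time hO hρ y hrO).sub_const (ρ 0 y)).const_mul σ).sub
          ((hasDerivAt_id r).const_mul CL)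
      have hρ2 : ContMDiffAt (𝓡 n) 𝓘(ℝ, ℝ) 2 (ρ r) y := ((hρs r hrO).of_le h2).contMDiffAt
      have hρ02 : ContMDiffAt (𝓡 n) 𝓘(ℝ, ℝ) 2 (ρ 0) y := (hρ0s.of_le h2).contMDiffAt
      have hu2 : ContMDiffAt (𝓡 n) 𝓘(ℝ, ℝ) 2 (fun y' ↦ σ * ρ r y' + -(CL * r)) y :=
        (contMDiffAt_const.mul hρ2).add contMDiffAt_const
      have hzr : z r = fun y' ↦ (σ * ρ r y' + -(CL * r)) + (-σ) * ρ 0 y' :=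
        funext fun y' ↦ by simp only [hzdef]; ring
      rw [hd.deriv, hzr, weightedLaplacian_add_const_mul hu2 hρ02, weightedLaplacian_affine hρ2,
        heq r hr y]
      have h1 : σ * (g.dalembertian (ρ 0) y - g.innerDual y (mvfderiv (𝓡 n) V y).toLinearMap
          (mvfderiv (𝓡 n) (ρ 0) y).toLinearMap) ≤ CL := by
        refine (le_abs_self _).trans ?_
        rw [abs_mul, hσ, one_mul]
        exact hCL y
      linarith
    have hz0 : ∀ y, z 0 y ≤ 0 := fun y ↦ by simp [hzdef]
    have hint' : Integrable (fun p : M × ℝ ↦ max (z p.2 p.1) 0 * Real.exp (-V p.1))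
        ((g.riemVolume.prod (volume : Measure ℝ)).restrict (univ ×ˢ Ioo 0 T)) := by
      refine hbound.mono' ?_ ?_
      · have hcont : ContinuousOn (fun p : M × ℝ ↦ max (z p.2 p.1) 0 * Real.exp (-V p.1))
            (univ ×ˢ O) :=
          (hzs.continuousOn.sup continuousOn_const).mul (hexpc.comp continuous_fst).continuousOn
        exact (hcont.mono (Set.prod_mono le_rfl (Ioo_subset_Icc_self.trans hTO))).aestronglyMeasurable
          hmeasS
      · rw [ae_restrict_iff' hmeasS]
        refine Eventually.of_forall fun p hp ↦ ?_
        obtain ⟨-, hr⟩ := hp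
        have hex := Real.exp_pos (-V p.1)
        have h1 : max (z p.2 p.1) 0 ≤ |ρ p.2 p.1 - c| + B := by
          refine max_le ?_ (add_nonneg (abs_nonneg _) hB0)
          simp only [hzdef]
          have h3 : σ * (ρ p.2 p.1 - ρ 0 p.1) ≤ |ρ p.2 p.1 - ρ 0 p.1| := by
            refine (le_abs_self _).trans ?_
            rw [abs_mul, hσ, one_mul]
          have h4 : |ρ p.2 p.1 - ρ 0 p.1| ≤ |ρ p.2 p.1 - c| + |ρ 0 p.1 - c| := by
            rw [show ρ p.2 p.1 - ρ 0 p.1 = (ρ p.2 p.1 - c) - (ρ 0 p.1 - c) by ring]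
            exact abs_sub _ _
          nlinarith [hB p.1, hr.1]
        have h2' : |ρ p.2 p.1 - c| ≤ (ρ p.2 p.1 - c) ^ 2 + 1 := by
          nlinarith [abs_nonneg (ρ p.2 p.1 - c), sq_abs (ρ p.2 p.1 - c)]
        rw [Real.norm_eq_abs, abs_of_nonneg (mul_nonneg (le_max_right _ _) hex.le)]
        nlinarith [le_max_right (z p.2 p.1) 0]
    exact helper_weightedMaxPrinciple n M g V hg hV η C hηs hηc hη01 hηmono hη1 hηL T O z hT hO hTO
      hzs hsub hz0 hint' s hs x
  have h1 := key 1 (by simp)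
  have h2' := key (-1) (by simp)
  rw [abs_le]
  constructor <;> linarith

omit [T2Space M] [g.HasLeviCivita] in
/-- **Time shifts stay in the energy class**: if `(ρ − c)² e^{-V}` is integrable on the strip
`M × (0, T)` then `(ρ(· + h) − c)² e^{-V}` is integrable on `M × (0, T − h)` for `0 ≤ h`
(translation invariance of Lebesgue measure). [folklore] -/
theorem integrable_strip_shift (hg : g.IsRiemannian) {F : M × ℝ → ℝ} {T h : ℝ} (hh : 0 ≤ h)
    (hF : Integrable F ((g.riemVolume.prod (volume : Measure ℝ)).restrict (univ ×ˢ Ioo 0 T))) :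
    Integrable (fun p : M × ℝ ↦ F (p.1, p.2 + h))
      ((g.riemVolume.prod (volume : Measure ℝ)).restrict (univ ×ˢ Ioo 0 (T - h))) := by
  haveI := CarrilloNi2009_shrinkerLSI.isFiniteMeasureOnCompacts_riemVolume hg
  haveI := sigmaFinite_riemVolume hg
  have hΦ : MeasurePreserving (Prod.map (id : M → M) (fun s : ℝ ↦ s + h))
      (g.riemVolume.prod (volume : Measure ℝ)) (g.riemVolume.prod (volume : Measure ℝ)) :=
    (MeasurePreserving.id g.riemVolume).prod (measurePreserving_add_right (volume : Measure ℝ) h)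
  have hpre : (Prod.map (id : M → M) (fun s : ℝ ↦ s + h)) ⁻¹' ((univ : Set M) ×ˢ Ioo h T) =
      (univ : Set M) ×ˢ Ioo 0 (T - h) := by
    ext ⟨y, r⟩
    simp only [mem_preimage, Prod.map_apply, mem_prod, mem_univ, true_and, mem_Ioo]
    constructor
    · rintro ⟨h1, h2⟩; exact ⟨by linarith, by linarith⟩
    · rintro ⟨h1, h2⟩; exact ⟨by linarith, by linarith⟩
  have hres := hΦ.restrict_preimage (MeasurableSet.univ.prod (measurableSet_Ioo (a := h) (b := T)))
  rw [hpre] at hres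
  have hF' : Integrable F ((g.riemVolume.prod (volume : Measure ℝ)).restrict (univ ×ˢ Ioo h T)) :=
    hF.mono_measure (Measure.restrict_mono (Set.prod_mono le_rfl (Ioo_subset_Ioo_left hh)) le_rfl)
  exact hres.integrable_comp_of_integrable hF'

/-- **Bounded `Lρ` along the energy-class heat flow**: for a solution `ρ` of `∂ₛρ = Lρ` on
`[0, T]` in the energy class with bounded `ρ(0) − c` and `|Lρ(0)| ≤ C_L`, `|Lρ(s)| ≤ C_L` for
`s ∈ [0, T)`. The difference quotients `(ρ(s + h) − ρ(s))/h` solve the same linear equation in the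
energy class and start below `C_L` in absolute value (`heatFlow_sub_datum_abs_le`), so they stay
below `C_L` (`helper_twoSidedBound`); let `h → 0⁺` (`Lρ = ∂ₛρ`).
[cite: Grigoryan2009, §11.4 and §12.1] -/
theorem heatFlow_weightedLaplacian_abs_le (hg : g.IsRiemannian) {V : M → ℝ}
    (hV : ContMDiff (𝓡 n) 𝓘(ℝ, ℝ) ∞ V) (hfin : Integrable (fun x ↦ Real.exp (-V x)) g.riemVolume)
    {η : ℕ → M → ℝ} {C : ℝ} (hηs : ∀ k, ContMDiff (𝓡 n) 𝓘(ℝ, ℝ) ∞ (η k))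
    (hηc : ∀ k, HasCompactSupport (η k)) (hη01 : ∀ k x, 0 ≤ η k x ∧ η k x ≤ 1)
    (hηmono : ∀ k x, η k x ≤ η (k + 1) x) (hη1 : ∀ x, ∀ᶠ k in atTop, ∀ᶠ y in 𝓝 x, η k y = 1)
    (hηL : ∀ k x, |g.dalembertian (η k) x - g.innerDual x (mvfderiv (𝓡 n) V x).toLinearMap
      (mvfderiv (𝓡 n) (η k) x).toLinearMap| ≤ C)
    {T : ℝ} {O : Set ℝ} {ρ : ℝ → M → ℝ} (hT : 0 < T) (hO : IsOpen O) (hTO : Icc 0 T ⊆ O)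
    (hρ : ContMDiffOn ((𝓡 n).prod 𝓘(ℝ, ℝ)) 𝓘(ℝ, ℝ) ∞ (fun p : M × ℝ ↦ ρ p.2 p.1) (univ ×ˢ O))
    (heq : ∀ s ∈ Icc 0 T, ∀ x, deriv (fun r ↦ ρ r x) s = g.dalembertian (ρ s) x
      - g.innerDual x (mvfderiv (𝓡 n) V x).toLinearMap (mvfderiv (𝓡 n) (ρ s) x).toLinearMap)
    {c B CL : ℝ} (hB : ∀ x, |ρ 0 x - c| ≤ B)
    (hCL : ∀ x, |g.dalembertian (ρ 0) x - g.innerDual x (mvfderiv (𝓡 n) V x).toLinearMap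
      (mvfderiv (𝓡 n) (ρ 0) x).toLinearMap| ≤ CL)
    (hint : Integrable (fun p : M × ℝ ↦ (ρ p.2 p.1 - c) ^ 2 * Real.exp (-V p.1))
      ((g.riemVolume.prod (volume : Measure ℝ)).restrict (univ ×ˢ Ioo 0 T))) :
    ∀ s ∈ Ico 0 T, ∀ x, |g.dalembertian (ρ s) x - g.innerDual x (mvfderiv (𝓡 n) V x).toLinearMap
      (mvfderiv (𝓡 n) (ρ s) x).toLinearMap| ≤ CL := by
  intro s hs x
  have h2 : (2 : ℕ∞ω) ≤ (∞ : ℕ∞ω) := WithTop.coe_le_coe.mpr le_top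
  have hexpc : Continuous fun y ↦ Real.exp (-V y) := Real.continuous_exp.comp hV.continuous.neg
  have hρs : ∀ r ∈ O, ContMDiff (𝓡 n) 𝓘(ℝ, ℝ) ∞ (ρ r) := fun r hr ↦ contMDiff_slice_of_contMDiffOn hρ hr
  have hlip := heatFlow_sub_datum_abs_le hg hV hfin hηs hηc hη01 hηmono hη1 hηL hT hO hTO hρ heq hB
    hCL hint
  -- the difference quotients are bounded by `C_L`
  have hquot : ∀ h : ℝ, 0 < h → h < T - s → |ρ (s + h) x - ρ s x| ≤ CL * h := by
    intro h hh hhT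
    set O' : Set ℝ := O ∩ (fun r ↦ r + h) ⁻¹' O with hO'def
    have hO' : IsOpen O' := hO.inter (hO.preimage (continuous_id.add continuous_const))
    have hTO' : Icc 0 (T - h) ⊆ O' := fun r hr ↦
      ⟨hTO ⟨hr.1, by linarith [hr.2]⟩, hTO ⟨by linarith [hr.1], by linarith [hr.2]⟩⟩
    set w : ℝ → M → ℝ := fun r y ↦ ρ (r + h) y + (-1) * ρ r y with hwdef
    have hsh : ContMDiffOn ((𝓡 n).prod 𝓘(ℝ, ℝ)) 𝓘(ℝ, ℝ) ∞ (fun p : M × ℝ ↦ ρ (p.2 + h) p.1)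
        (univ ×ˢ O') := by
      have hmap : ContMDiff ((𝓡 n).prod 𝓘(ℝ, ℝ)) ((𝓡 n).prod 𝓘(ℝ, ℝ)) ∞
          (fun p : M × ℝ ↦ (p.1, p.2 + h)) :=
        contMDiff_fst.prodMk (contMDiff_snd.add contMDiff_const)
      exact hρ.comp hmap.contMDiffOn fun p hp ↦ ⟨mem_univ _, hp.2.2⟩
    have hws : ContMDiffOn ((𝓡 n).prod 𝓘(ℝ, ℝ)) 𝓘(ℝ, ℝ) ∞ (fun p : M × ℝ ↦ w p.2 p.1)
        (univ ×ˢ O') :=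
      hsh.add (contMDiffOn_const.mul (hρ.mono (Set.prod_mono le_rfl inter_subset_left)))
    have heqw : ∀ r ∈ Icc 0 (T - h), ∀ y, deriv (fun r' ↦ w r' y) r = g.dalembertian (w r) y -
        g.innerDual y (mvfderiv (𝓡 n) V y).toLinearMap (mvfderiv (𝓡 n) (w r) y).toLinearMap := by
      intro r hr y
      have hr' : r ∈ Icc 0 T := ⟨hr.1, by linarith [hr.2]⟩
      have hrh : r + h ∈ Icc 0 T := ⟨by linarith [hr.1], by linarith [hr.2]⟩
      have hd : HasDerivAt (fun r' ↦ w r' y)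
          (deriv (fun r' ↦ ρ r' y) (r + h) + (-1) * deriv (fun r' ↦ ρ r' y) r) r :=
        (HasDerivAt.comp_add_const r h (hasDerivAt_time hO hρ y (hTO hrh))).add
          ((hasDerivAt_time hO hρ y (hTO hr')).const_mul (-1))
      rw [hd.deriv, heq (r + h) hrh y, heq r hr' y,
        show w r = fun y' ↦ ρ (r + h) y' + (-1) * ρ r y' from rfl,
        weightedLaplacian_add_const_mul (((hρs _ (hTO hrh)).of_le h2).contMDiffAt)
          (((hρs _ (hTO hr')).of_le h2).contMDiffAt)]
    have hw0 : ∀ y, -(CL * h) ≤ w 0 y ∧ w 0 y ≤ CL * h := fun y ↦ by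
      have h1 := hlip h ⟨hh.le, by linarith [hs.1]⟩ y
      simp only [hwdef, zero_add]
      rw [abs_le] at h1
      constructor <;> linarith [h1.1, h1.2]
    have hintw : Integrable (fun p : M × ℝ ↦ (w p.2 p.1 - 0) ^ 2 * Real.exp (-V p.1))
        ((g.riemVolume.prod (volume : Measure ℝ)).restrict (univ ×ˢ Ioo 0 (T - h))) := by
      have hA := integrable_strip_shift hg hh.le hint
      have hB' : Integrable (fun p : M × ℝ ↦ (ρ p.2 p.1 - c) ^ 2 * Real.exp (-V p.1))
          ((g.riemVolume.prod (volume : Measure ℝ)).restrict (univ ×ˢ Ioo 0 (T - h))) :=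
        hint.mono_measure (Measure.restrict_mono (Set.prod_mono le_rfl
          (Ioo_subset_Ioo_right (by linarith))) le_rfl)
      have hbound : Integrable (fun p : M × ℝ ↦ 2 * ((ρ (p.2 + h) p.1 - c) ^ 2 * Real.exp (-V p.1)
          + (ρ p.2 p.1 - c) ^ 2 * Real.exp (-V p.1)))
          ((g.riemVolume.prod (volume : Measure ℝ)).restrict (univ ×ˢ Ioo 0 (T - h))) :=
        (hA.add hB').const_mul 2
      refine hbound.mono' ?_ (ae_of_all _ fun p ↦ ?_)
      · have hcont : ContinuousOn (fun p : M × ℝ ↦ (w p.2 p.1 - 0) ^ 2 * Real.exp (-V p.1))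
            (univ ×ˢ O') :=
          ((hws.continuousOn.sub continuousOn_const).pow 2).mul
            (hexpc.comp continuous_fst).continuousOn
        exact (hcont.mono (Set.prod_mono le_rfl (Ioo_subset_Icc_self.trans hTO'))).aestronglyMeasurable
          (MeasurableSet.univ.prod measurableSet_Ioo)
      · have hex := Real.exp_pos (-V p.1)
        rw [Real.norm_eq_abs, abs_of_nonneg (mul_nonneg (sq_nonneg _) hex.le)]
        simp only [hwdef]
        have : (ρ (p.2 + h) p.1 + (-1) * ρ p.2 p.1 - 0) ^ 2 ≤
            2 * ((ρ (p.2 + h) p.1 - c) ^ 2 + (ρ p.2 p.1 - c) ^ 2) := by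
          nlinarith [sq_nonneg (ρ (p.2 + h) p.1 + ρ p.2 p.1 - 2 * c)]
        nlinarith
    have hCL0 : 0 ≤ CL := (abs_nonneg _).trans (hCL x)
    have hb := helper_twoSidedBound n M g V hg hV hfin η C hηs hηc hη01 hηmono hη1 hηL (T - h) O' w
      (by linarith [hs.1]) hO' hTO' hws heqw 0 (-(CL * h)) (CL * h)
      (neg_nonpos.2 (mul_nonneg hCL0 hh.le)) (mul_nonneg hCL0 hh.le) hw0 hintw s
      ⟨hs.1, by linarith⟩ x
    simp only [hwdef] at hb
    rw [abs_le]
    constructor <;> linarith [hb.1, hb.2]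
  -- pass to the limit `h → 0⁺`
  have hsT : s ∈ Icc 0 T := ⟨hs.1, hs.2.le⟩
  have hd : HasDerivAt (fun r ↦ ρ r x) (deriv (fun r ↦ ρ r x) s) s := hasDerivAt_time hO hρ x (hTO hsT)
  have hlim : Tendsto (fun t ↦ |t⁻¹ • (ρ (s + t) x - ρ s x)|) (𝓝[>] 0)
      (𝓝 |deriv (fun r ↦ ρ r x) s|) :=
    (continuous_abs.tendsto _).comp hd.tendsto_slope_zero_right
  have hev : ∀ᶠ t in 𝓝[>] (0 : ℝ), |t⁻¹ • (ρ (s + t) x - ρ s x)| ≤ CL := by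
    filter_upwards [Ioo_mem_nhdsGT (show (0 : ℝ) < T - s by linarith [hs.2])] with t ht
    rw [smul_eq_mul, abs_mul, abs_inv, abs_of_pos ht.1]
    calc t⁻¹ * |ρ (s + t) x - ρ s x| ≤ t⁻¹ * (CL * t) :=
          mul_le_mul_of_nonneg_left (hquot t ht.1 ht.2) (inv_nonneg.2 ht.1.le)
      _ = CL := by rw [mul_comm CL t, ← mul_assoc, inv_mul_cancel₀ ht.1.ne', one_mul]
  have hfin' := le_of_tendsto hlim hev
  rwa [heq s hsT x] at hfin'

end Weighted

/-! ### Registered forms -/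

/-- **Helper `helper_liWangHeatLaplacianBound`** (registered form of
`heatFlow_weightedLaplacian_abs_le`): along the energy-class weighted heat flow on `[0, T]` with
bounded `ρ(0) − c` and `|Lρ(0)| ≤ C_L`, `|Lρ(s)| ≤ C_L` for `s ∈ [0, T)`.
[cite: Grigoryan2009, §11.4 and §12.1] [cite: BakryGentilLedoux2014, §1.4 and §3.2 (pp. 141–147)] -/
theorem helper_liWangHeatLaplacianBound : ∀ (n : ℕ) (M : Type) [TopologicalSpace M] [T2Space M] [SecondCountableTopology M] [ChartedSpace (EuclideanSpace ℝ (Fin n)) M] [IsManifold (𝓡 n) ∞ M] [T3Space M] [MeasurableSpace M] [BorelSpace M] (g : PseudoRiemannianMetric (𝓡 n) ∞ (EuclideanSpace ℝ (Fin n)) (TangentSpace (𝓡 n) : M → Type _)) [g.HasLeviCivita] (V : M → ℝ), g.IsRiemannian → ContMDiff (𝓡 n) 𝓘(ℝ, ℝ) ∞ V → Integrable (fun x ↦ Real.exp (-V x)) g.riemVolume → ∀ (η : ℕ → M → ℝ) (C : ℝ), (∀ k, ContMDiff (𝓡 n) 𝓘(ℝ, ℝ) ∞ (η k)) → (∀ k,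 HasCompactSupport (η k)) → (∀ k x, 0 ≤ η k x ∧ η k x ≤ 1) → (∀ k x, η k x ≤ η (k + 1) x) → (∀ x, ∀ᶠ k in atTop, ∀ᶠ y in 𝓝 x, η k y = 1) → (∀ k x, |g.dalembertian (η k) x - g.innerDual x (mvfderiv (𝓡 n) V x).toLinearMap (mvfderiv (𝓡 n) (η k) x).toLinearMap| ≤ C) → ∀ (T : ℝ) (O : Set ℝ) (ρ : ℝ → M → ℝ), 0 < T → IsOpen O → Icc 0 T ⊆ O → ContMDiffOn ((𝓡 n).prod 𝓘(ℝ, ℝ)) 𝓘(ℝ, ℝ) ∞ (fun p : M × ℝ ↦ ρ p.2 p.1) (univ ×ˢ O) → (∀ s ∈ Icc 0 T, ∀ x, deriv (fun r ↦ ρ r x) s = g.dalembertian (ρ s) x - g.innerDual x (mvfderiv (𝓡 n) V x).toLinearMap (mvfderiv (𝓡 n) (ρ s) x).toLinearMap) → ∀ (c B CL : ℝ), (∀ x, |ρ 0 x - c| ≤ B) → (∀ x, |g.dalembertian (ρ 0) x - g.innerDual x (mvfderiv (𝓡 n) V x).toLinearMap (mvfderiv (𝓡 n) (ρ 0) x).toLinearMap|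 ≤ CL) → Integrable (fun p : M × ℝ ↦ (ρ p.2 p.1 - c) ^ 2 * Real.exp (-V p.1)) ((g.riemVolume.prod (volume : Measure ℝ)).restrict (univ ×ˢ Ioo 0 T)) → ∀ s ∈ Ico 0 T, ∀ x, |g.dalembertian (ρ s) x - g.innerDual x (mvfderiv (𝓡 n) V x).toLinearMap (mvfderiv (𝓡 n) (ρ s) x).toLinearMap| ≤ CL := by
  intro n M _ _ _ _ _ _ _ _ g _ V hg hV hfin η C hηs hηc hη01 hηmono hη1 hηL T O ρ hT hO hTO hρ heq c B CL hB
    hCL hint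
  exact heatFlow_weightedLaplacian_abs_le hg hV hfin hηs hηc hη01 hηmono hη1 hηL hT hO hTO hρ heq hB hCL hint

end Summit.SmoothPoincare4.SmoothPoincare4.Theorems.NoncompactShrinkerGapLiWang

end
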